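import Summits.HodgeConjecture.HodgeConjecture.Theorems.F0P6aSiegelCarrierReciprocity
import Literature.AlgebraicGeometry.ShimuraVarieties.UnitaryCurveSpecialPairReciprocityMover
import HarnessLib

/-!
# The CM reciprocity square of the E-line chart WITH A CENTRAL TWIST: `σ • f [ι₁w, aK] = f₂ [ι₁w, d·aK]` for a second point map of shadow `[J v, b(a)·z]`

Summit `HodgeConjecture`, sub-problem `HodgeConjecture`, crux `stmt-HodgeConjecture-24832` (HLiu418), sub-line P6a, line «L4», X-LEAF `Lines/F0_P6a_EExports.lean`
(A-p01 (g28)) socket `stub_ESHEET`, organ map `MEMO-ESHEET-organs.v2` (S3)∕(S3♯) (LA4-plan (g2) DEAL #28 → LA4-p03 (g2)).  Cell `hodgecm-mathlib` (D-0151);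
HONEST LABEL: HC_CM is proved only modulo the 2 remaining named inputs (hLiu418 24832, h413 24833) until rung 0 closes; this file is a `--supports 24832`
helper and changes no count.  THEOREMS ONLY; imports ★ Theorems ∕ ★ Literature only (no `Lines`).

THE ONE THEOREM `smul_f_mk_eq_fTwo_mk_of_cmDatum_central` is the twin of ★ `F0P6aSpecialPairRecipDatumOfChart.smul_f_mk_eq_of_cmDatum` (E3R-S glue:
CM datum at `(σ, w, d, a)` ⇒ `σ • f [ι₁w, aK] = f [ι₁w, d·aK]`) in which the Siegel class identity carries a CENTRAL factor `z` on the right and the conclusion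
reads a SECOND point map `f₂` with shadow `[J v, b(a)·z]`: `σ • f [ι₁w, aK] = f₂ [ι₁w, d·aK]`.  With `z = ũ_V(1, t)` (`t = N_{Ψ₊}(s)` the central reflex-norm idèle
of ★ (S2a) `exists_siegelRecipDatum_centralTwist_of_isGalois`, torus law `ũ(d′,t)·ũ(a,1) = ũ(d′a,1)·ũ(1,t)`) and `f₂ = ψ_𝔞`'s point map ((S2b) ★ p849685) this is the
twisted reciprocity law `htw` consumed by ★ `RecordSystemGS.conjSlice_eq_sliceTwo_of_twisted_recip` (p849897) — the (S3) step `T′ = ψ_𝔞` of the sheet line.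
[cite: Milne2005ShimuraVarieties, Def. 12.8 (62) p. 114 and Thm. 13.6 p. 118] [cite: Shimura1998, §18.6 (pp. 124–127)]
[cite: Deligne1971TravauxShimura, 5.11 p. 158, Thm. 4.21 p. 152] [cite: RapoportSmithlingZhang2020Diagonal, §3.2 p. 11, Remark 3.1 p. 9]
-/

set_option autoImplicit false

noncomputable section

-- the mandated namespace has the single-problem summit's repeated segment (`HodgeConjecture.HodgeConjecture`)
set_option linter.dupNamespace false

namespace Summit.HodgeConjecture.HodgeConjecture.Theorems.F0P6aSpecialPairRecipDatumCentralTwist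

open CategoryTheory AlgebraicGeometry Matrix NumberField IsDedekindDomain
open Literature.AlgebraicGeometry.ModuliOfAbelianVarieties
open Literature.AlgebraicGeometry.ModuliOfAbelianVarieties.SiegelModuli (jOfSiegel jOfSiegel_mem_C0)
open Literature.AlgebraicGeometry.Motives (SchemeOver ComplexPoints AlgPoints specOver CMType)
open Literature.AlgebraicGeometry.AbelianSchemes (PolarizedAbelianSchemeWithLevel)
open Literature.NumberTheory.Automorphic Literature.NumberTheory.Automorphic.UnitaryGroup
open Literature.NumberTheory.ComplexMultiplication (traceField)
open Literature.AlgebraicGeometry.ShimuraVarieties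
open Literature.AlgebraicGeometry.ShimuraVarieties.UnitaryCanonicalModel (IsArtinCorrespondent recipFactor IsDiagTwistGS ShimuraSetGS)
open Literature.AlgebraicGeometry.ShimuraVarieties.UnitaryCurve.AuxV
open Summit.HodgeConjecture.HodgeConjecture.Theorems.F0P6aSiegelCarrierReciprocity (smul_q_mk_eq_q_mk_cmRecip_of_forall_mem_apply_eq)

/-! ### §1 E3R-S glue with a central factor: the CM datum at `(σ, w, d, a)` gives the TWISTED `f_recip` equation -/

/-- **E3R-S GLUE WITH A CENTRAL TWIST — THE (S3♯) SQUARE «`σ • f [ι₁w, aK] = f₂ [ι₁w, d·aK]`» FOR A SECOND POINT MAP `f₂` WHOSE SIEGEL SHADOW IS THE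
`z`-TRANSLATE OF `f`'s** (twin of ★ `smul_f_mk_eq_of_cmDatum` with the Siegel class identity carrying a CENTRAL factor `z ∈ GSp_δ(𝔸_f)` on the right:
`[J(ι₁w), r·b a] = [J(ι₁w), b(d′a)·z]`, the torus law of ★ (S2a) `exists_siegelRecipDatum_centralTwist_of_isGalois` read through the chart's frame pin
`b = ũ_V(·, 1)`, `z = ũ_V(1, t)`, `t` the central reflex-norm idèle).  Chart-generic: the Siegel data `(𝓜, ιc, unif, u, rep, pts)` with (U3)∕(D3), ANY `J b f` with the
shadow formula `pts (f [v, aK]) = [J v, b a]`, ANY `f₂` with `pts (f₂ [v, aK]) = [J v, b a · z]` (the tensored slice `ψ_𝔞` of (S2b)), and at `(σ, w, d, a)` a CM datum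
`(E, c, Φ′, sE, r, d′)` as in ★ `cmConjugationIsogenyAll_holds` for `σ ∈ Aut(ℂ∕E)`, `E ⊇ E*(Φ′ᵢ)` (so `σ` over the reflex field — for `F∕ℚ` Galois, any
`σ ∈ Aut(ℂ∕ι₁F)`).  PROOF = ★ E3R-S `smul_q_mk_eq_q_mk_cmRecip_of_forall_mem_apply_eq` at the special pair + the two shadow formulas.  Consumer: the `htw`
hypothesis of ★ `RecordSystemGS.conjSlice_eq_sliceTwo_of_twisted_recip` (p849897), after the source record's `recip` at `σ` and `σ⁻¹` turns `d·a` round.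
[cite: Milne2005ShimuraVarieties, Def. 12.8 (62) p. 114 and Prop. 14.12 p. 125] [cite: Deligne1971TravauxShimura, Thm. 4.21 p. 152] -/
theorem smul_f_mk_eq_fTwo_mk_of_cmDatum_central {g N : ℕ} {δ : Fin g → ℕ} (hg : 0 < g) (hδ : IsPolarizationType δ) (hN : 3 ≤ N)
    (𝓜 : SiegelFineModuliScheme g N δ)
    {Sc : (ZMod N)ˣ → SchemeOver ℂ} (ιc : ∀ c, Sc c ⟶ (Literature.AlgebraicGeometry.Motives.baseChange ℚ ℂ).obj 𝓜.M)
    (unif : ∀ _c : (ZMod N)ˣ, Matrix (Fin g) (Fin g) ℂ → ComplexPoints (Sc _c))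
    {u : (ZMod N)ˣ → finAdeleQˣ} {rep : (ZMod N)ˣ → ↥(gspFinAdelic δ)}
    (hu : ∀ c w, Valued.v ((u c : finAdeleQ) w) = 1)
    (huc : ∀ c, (u c : finAdeleQ) - ((c : ZMod N).val : ℕ) ∈ levelIdeal N)
    (hmult : ∀ c, IsMultiplier (typeFormOver δ finAdeleQ) (rep c : GL (Fin g ⊕ Fin g) finAdeleQ) (u c))
    (hD3 : haveI : IsLocallyNoetherian (specOver ℚ ℂ).left := inferInstanceAs (IsLocallyNoetherian (Spec (CommRingCat.of ℂ)))
      ∀ (c : (ZMod N)ˣ) (Z : Matrix (Fin g) (Fin g) ℂ) (hZ : Z ∈ siegelUpperHalfSpace g)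
        (P' : PolarizedAbelianSchemeWithLevel g N δ (specOver ℚ ℂ).left), IsAdmissibleAt hδ (rep c) Z hZ P' →
          AlgPoints.map (ιc c) (unif c Z) =
            AlgPoints.baseChangeEquiv (algebraMap ℚ ℂ) 𝓜.M (𝓜.classifyingMap (specOver ℚ ℂ) P'))
    (pts : ComplexPoints ((Literature.AlgebraicGeometry.Motives.baseChange ℚ ℂ).obj 𝓜.M) ≃
      SiegelShimuraSet δ (principalLevelSubgroup δ N))
    (hval : ∀ (c : (ZMod N)ˣ) (W : Matrix (Fin g) (Fin g) ℂ) (hW : W ∈ siegelUpperHalfSpace g),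
      pts (AlgPoints.map (ιc c) (unif c W)) =
        SiegelShimuraSet.mk δ (principalLevelSubgroup δ N)
          ⟨jOfSiegel δ W, C0_subset_C0pm δ (jOfSiegel_mem_C0 hδ.1 hW)⟩ (rep c))
    -- the curve datum, ANY Hodge-embedding datum, ANY group map, ANY point map with the shadow formula
    {F : Type} [Field F] [NumberField F] [IsCMField F] (ι₁ : F →+* ℂ) (Jstar : Matrix (Fin 2) (Fin 2) F)
    (J : (Fin 2 → ℂ) → Matrix (Fin g ⊕ Fin g) (Fin g ⊕ Fin g) ℝ)
    (hJC : ∀ v : Fin 2 → ℂ, v ∈ negCone (Jstar.map ι₁) → J v ∈ C0pm δ)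
    (K : Subgroup ↥(finAdelic (↥(maximalRealSubfield F)) F (IsCMField.complexConj F) 2 Jstar))
    (b : ↥(finAdelic (↥(maximalRealSubfield F)) F (IsCMField.complexConj F) 2 Jstar) → ↥(gspFinAdelic δ))
    (f : ShimuraSetGS F Jstar ι₁ K → ComplexPoints 𝓜.M)
    (hf : ∀ (v : Fin 2 → ℂ) (hv : v ∈ negCone (Jstar.map ι₁)) (a : ↥(finAdelic (↥(maximalRealSubfield F)) F (IsCMField.complexConj F) 2 Jstar)),
      pts (AlgPoints.baseChangeEquiv (algebraMap ℚ ℂ) 𝓜.M (f (ShimuraSetGS.mk F Jstar ι₁ K v hv a))) =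
        SiegelShimuraSet.mk δ (principalLevelSubgroup δ N) ⟨J v, hJC v hv⟩ (b a))
    -- a SECOND point map `f₂` whose Siegel shadow is the CENTRAL TRANSLATE `[J v, b(a)·z]` of `f`'s (the tensored slice `ψ_𝔞` of (S2b))
    (z : ↥(gspFinAdelic δ)) (f₂ : ShimuraSetGS F Jstar ι₁ K → ComplexPoints 𝓜.M)
    (hf₂ : ∀ (v : Fin 2 → ℂ) (hv : v ∈ negCone (Jstar.map ι₁)) (a : ↥(finAdelic (↥(maximalRealSubfield F)) F (IsCMField.complexConj F) 2 Jstar)),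
      pts (AlgPoints.baseChangeEquiv (algebraMap ℚ ℂ) 𝓜.M (f₂ (ShimuraSetGS.mk F Jstar ι₁ K v hv a))) =
        SiegelShimuraSet.mk δ (principalLevelSubgroup δ N) ⟨J v, hJC v hv⟩ (b a * z))
    -- the point `(σ, w, d, a)` and the CM datum there
    (σ : ℂ ≃ₐ[ℚ] ℂ) (w : Fin 2 → F) (hw : (fun i => ι₁ (w i)) ∈ negCone (Jstar.map ι₁))
    (d a : ↥(finAdelic (↥(maximalRealSubfield F)) F (IsCMField.complexConj F) 2 Jstar))
    (E : IntermediateField ℚ ℂ) [NumberField ↥E] (c : CMStructure g δ (Fin 2) (fun _ => F)) (Φ' : Fin 2 → CMType F)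
    (sE : (FiniteAdeleRing (𝓞 ↥E) ↥E)ˣ) (r : ↥(gspFinAdelic δ)) (d' : ↥(finAdelic (↥(maximalRealSubfield F)) F (IsCMField.complexConj F) 2 Jstar))
    (hsp : c.IsSpecial ⟨J (fun i => ι₁ (w i)), hJC _ hw⟩ Φ') (hE : ∀ i, traceField (Φ' i) ≤ E) (hσ : ∀ x : ℂ, x ∈ E → σ x = x)
    (hsE : IsArtinCorrespondent ↥E (algebraMap ↥E ℂ) sE σ.toRingEquiv)
    (hr : ((r : GL (Fin g ⊕ Fin g) finAdeleQ) : Matrix (Fin g ⊕ Fin g) (Fin g ⊕ Fin g) finAdeleQ) = c.cmRecipMatrix Φ' E sE)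
    -- the CENTRAL-TWIST class identity (S2a): `[J(ι₁w), r·b a] = [J(ι₁w), b(d′a)·z]` (torus law `ũ(d′,t)·ũ(a,1) = ũ(d′a,1)·ũ(1,t)`, `z = ũ(1,t)`)
    (hS : SiegelShimuraSet.mk δ (principalLevelSubgroup δ N) ⟨J (fun i => ι₁ (w i)), hJC _ hw⟩ (r * b a) =
      SiegelShimuraSet.mk δ (principalLevelSubgroup δ N) ⟨J (fun i => ι₁ (w i)), hJC _ hw⟩ (b (d' * a) * z))
    (hK : ShimuraSetGS.mk F Jstar ι₁ K (fun i => ι₁ (w i)) hw (d * a) = ShimuraSetGS.mk F Jstar ι₁ K (fun i => ι₁ (w i)) hw (d' * a)) :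
    σ • f (ShimuraSetGS.mk F Jstar ι₁ K (fun i => ι₁ (w i)) hw a) = f₂ (ShimuraSetGS.mk F Jstar ι₁ K (fun i => ι₁ (w i)) hw (d * a)) := by
  classical
  -- E3R-S at the special pair `(c, J(ι₁ w), Φ′)` and the class `[J(ι₁w), b a]`
  have hSrec := smul_q_mk_eq_q_mk_cmRecip_of_forall_mem_apply_eq hg hδ hN 𝓜 ιc unif hu huc hmult hD3 pts hval (Fin 2) (fun _ => F) c
    ⟨J (fun i => ι₁ (w i)), hJC _ hw⟩ Φ' hsp E hE σ hσ sE hsE r hr (b a)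
  -- read both sides through `f` by the shadow formula
  have hread : ∀ a' : ↥(finAdelic (↥(maximalRealSubfield F)) F (IsCMField.complexConj F) 2 Jstar),
      f (ShimuraSetGS.mk F Jstar ι₁ K (fun i => ι₁ (w i)) hw a') =
        (AlgPoints.baseChangeEquiv (algebraMap ℚ ℂ) 𝓜.M).symm (pts.symm (SiegelShimuraSet.mk δ (principalLevelSubgroup δ N)
          ⟨J (fun i => ι₁ (w i)), hJC _ hw⟩ (b a'))) := by
    intro a'
    have h1 : (AlgPoints.baseChangeEquiv (algebraMap ℚ ℂ) 𝓜.M) (f (ShimuraSetGS.mk F Jstar ι₁ K (fun i => ι₁ (w i)) hw a')) =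
        pts.symm (SiegelShimuraSet.mk δ (principalLevelSubgroup δ N) ⟨J (fun i => ι₁ (w i)), hJC _ hw⟩ (b a')) :=
      (Equiv.eq_symm_apply pts).2 (hf _ hw a')
    exact (Equiv.eq_symm_apply (AlgPoints.baseChangeEquiv (algebraMap ℚ ℂ) 𝓜.M)).2 h1
  have hread₂ : ∀ a' : ↥(finAdelic (↥(maximalRealSubfield F)) F (IsCMField.complexConj F) 2 Jstar),
      f₂ (ShimuraSetGS.mk F Jstar ι₁ K (fun i => ι₁ (w i)) hw a') =
        (AlgPoints.baseChangeEquiv (algebraMap ℚ ℂ) 𝓜.M).symm (pts.symm (SiegelShimuraSet.mk δ (principalLevelSubgroup δ N)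
          ⟨J (fun i => ι₁ (w i)), hJC _ hw⟩ (b a' * z))) := by
    intro a'
    have h1 : (AlgPoints.baseChangeEquiv (algebraMap ℚ ℂ) 𝓜.M) (f₂ (ShimuraSetGS.mk F Jstar ι₁ K (fun i => ι₁ (w i)) hw a')) =
        pts.symm (SiegelShimuraSet.mk δ (principalLevelSubgroup δ N) ⟨J (fun i => ι₁ (w i)), hJC _ hw⟩ (b a' * z)) :=
      (Equiv.eq_symm_apply pts).2 (hf₂ _ hw a')
    exact (Equiv.eq_symm_apply (AlgPoints.baseChangeEquiv (algebraMap ℚ ℂ) 𝓜.M)).2 h1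
  rw [hK, hread a, hSrec, hS, ← hread₂ (d' * a)]


end Summit.HodgeConjecture.HodgeConjecture.Theorems.F0P6aSpecialPairRecipDatumCentralTwist

end
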